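import Literature.AlgebraicGeometry.Frobenioids.EndomorphismsCounterexample
import HarnessLib

/-!
# Frobenioids I, Proposition 1.12: the hypothesis (H) `AutFixesDiv` fails for the elementary
# counterexample Frobenioid — kernel witness

Mochizuki, *The geometry of Frobenioids I: the general theory*, Kyushu J. Math. **62** (2008)
293–400, §1, Proposition 1.12 (ii), kurims text p. 39 [cite: MochizukiFrdI2008, Prop. 1.12(ii) p.39].
Proof-only companion (abc-iut cell, seat abc-iut-w5-d127; no definition, no named fact) to
`Endomorphisms.lean` (the hypothesis `PreFrobenioid.AutFixesDiv F` — "automorphisms act trivially on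
zero divisors", the equality the printed proof of Prop. 1.12 (ii) uses) and
`EndomorphismsCounterexample.lean` (the Frobenioid `F_Φ → F_{Φ^char}` over the one-object category of
`ℤ` with `Φ(pt) = ℚ_{≥0}`, generator acting by `2`, in which Prop. 1.12 (ii)–(iv) fail as printed).

* `EndomorphismsCounterexample.not_autFixesDiv` — (H) FAILS for that Frobenioid: otherwise
  `PreFrobenioid.endoIsSubAutomorphismIffStatement_of_autFixesDiv` would give Prop. 1.12 (ii) at the
  object `A`, contradicting `not_endoIsSubAutomorphismIffStatement`.

Consequence for the cell's bookkeeping (plan/FACT-LIST.md row F-1076 `AutFixesDiv`, listed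
«admissible, fact-open, parametrised»): the schema `∀ F, AutFixesDiv F` is kernel-refuted at an
instance, so the row is consumable AT NAMED INSTANCES ONLY (it is a hypothesis predicate, as its own
docstring says), never as a universal fact.  Prop. 1.12 is not cited by [IUTchI–IV] or [EtTh].
Nothing here bears on [IUTchIII] Cor. 3.12.
-/

namespace Literature.AlgebraicGeometry.Frobenioids

open CategoryTheory

namespace EndomorphismsCounterexample

/-- **Hypothesis (H) of Prop. 1.12 (ii) fails for the counterexample Frobenioid `F_Φ → F_{Φ^char}`**
(`Φ(pt) = ℚ_{≥0}` on `B(ℤ)`, generator acting by `2`): if every automorphism fixed zero divisors,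
Prop. 1.12 (ii) would hold at `A` (`endoIsSubAutomorphismIffStatement_of_autFixesDiv`), which it does
not (`not_endoIsSubAutomorphismIffStatement`). [cite: MochizukiFrdI2008, Prop. 1.12(ii) p.39] -/
theorem not_autFixesDiv : ¬ PreFrobenioid.AutFixesDiv (ElemFrobenioid.toChar Φex) :=
  fun hH => not_endoIsSubAutomorphismIffStatement
    (PreFrobenioid.endoIsSubAutomorphismIffStatement_of_autFixesDiv isFrobenioid hH A)

/-- Hence (H) is not a theorem schema: there is a Frobenioid (in the sense of [FrdI] Def. 1.3) for
which `AutFixesDiv` fails. [cite: MochizukiFrdI2008, Prop. 1.12(ii) p.39] -/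
theorem exists_isFrobenioid_not_autFixesDiv :
    ∃ (F : ElemFrobenioid Φex ⥤ ElemFrobenioid (charFunctor Φex)),
      PreFrobenioid.IsFrobenioid F ∧ ¬ PreFrobenioid.AutFixesDiv F :=
  ⟨ElemFrobenioid.toChar Φex, isFrobenioid, not_autFixesDiv⟩

end EndomorphismsCounterexample

end Literature.AlgebraicGeometry.Frobenioids
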